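import Literature.AlgebraicGeometry.Frobenioids.ModelFrobenioidComparison
import Literature.AlgebraicGeometry.Frobenioids.ModelFrobenioidStandard
import HarnessLib

/-!
# Frobenioids I, Theorem 5.2 (ii), second sentence: the rational function monoid of a model
# Frobenioid is `B` (statement)

Mochizuki, *The geometry of Frobenioids I: the general theory*, Kyushu J. Math. **62** (2008)
293–400, §5, Theorem 5.2 (ii), kurims text p. 101 [cite: MochizukiFrdI2008, Thm. 5.2(ii) p.101]:

  "(ii) The category `C` is a Frobenioid [with respect to the functor `C → F_Φ`] of isotropic and
  model — hence, in particular, birationally Frobenius-normalized — type. We shall refer to `C` as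
  the *model Frobenioid* defined by the divisor monoid `Φ` and the rational function monoid `B`
  [which we regard as equipped with the homomorphism `Div_B : B → Φ^gp`]. Moreover, there is a
  natural isomorphism of functors between the functor "`O^×(−)`" on `D` associated to the
  Frobenioid `C^birat` [cf. Propositions 2.2, (ii), (iii); 4.4, (ii)] and the functor `B`; this
  isomorphism is compatible with the homomorphisms `O^×(−) → Φ^gp` [cf. Proposition 4.4, (iii)],
  `Div_B : B → Φ^gp`."

**This file** types the LAST sentence ("Moreover, …") for the model Frobenioid
`ModelFrobenioid Φ B DivB` of Thm. 5.2 (i) (file `ModelFrobenioid.lean`) with its functor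
`ModelFrobenioid.toElem : C → F_Φ` (file `ModelFrobenioidFunctor.lean`).  The first sentence
(Frobenioid of isotropic and model type) is seat abc-iut-found's proof duty (its staged
`ModelFrobenioid.isFrobenioid` / `isOfIsotropicType`); here the Frobenioid structure enters as the
binder `hF : IsFrobenioid (toElem Φ B DivB)`, under the standing hypotheses
`ModelFrobenioid.Hypotheses Φ B` of Thm. 5.2 (file `ModelFrobenioidStandard.lean`).

**Rendering of "`B` is [isomorphic to] the rational function monoid, compatibly with `Div_B`".**
The functor "`O^×(−)` on `D` associated to `C^birat`" is determined by Prop. 2.2 (ii) only up to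
isomorphism; its canonical object-level value `O^×(A^birat)` is `PreFrobenioid.BiratUnits F hF A`
(file `BiratUnits.lean`, L1-lead ruling C5′), with divisor map
`BiratUnits.divHom : O^×(A^birat) → Φ^gp(A)` (Prop. 4.4 (i)/(iii), file `BiratUnitsDiv.lean`).  The
assertion "natural isomorphism `O^×(−) ≅ B` compatible with `O^×(−) → Φ^gp` and `Div_B`" is then
EXACTLY the structure `PreFrobenioid.RationalFunctionMonoidStr F hF B DivB` of file
`ModelFrobenioidComparison.lean` (isomorphisms `B(Base A) ≃ O^×(A^birat)` for all `A`, compatible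
with the divisor maps, natural along linear morphisms in the sense of Prop. 2.2 (ii)(a)(b)) — the
same structure through which Thm. 5.2 (iv) says "`B` is the rational function monoid associated to
`C`".  So the sentence is typed as: that structure is inhabited for `F = toElem Φ B DivB`.
Statement only (`def … : Prop`); the proof (FrdI pp. 101–102: a base-identity endomorphism of
`A^birat` is a fraction `(α, φ)` of base-equivalent pre-steps, whose unit components differ by an
element of `B(A_D)`) is not attempted here.
-/

namespace Literature.AlgebraicGeometry.Frobenioids

open CategoryTheory Opposite

universe w v u

namespace ModelFrobenioid

variable {D : Type u} [Category.{v} D] (Φ B : Dᵒᵖ ⥤ CommMonCat.{w}) (DivB : B ⟶ monoidGp Φ)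

/-- **Thm. 5.2 (ii)**, last sentence (statement): for the model Frobenioid `C` of `(Φ, B, Div_B)`
under the hypotheses of Thm. 5.2, "there is a natural isomorphism of functors between the functor
`O^×(−)` on `D` associated to the Frobenioid `C^birat` [Props. 2.2 (ii), (iii); 4.4 (ii)] and the
functor `B`; this isomorphism is compatible with the homomorphisms `O^×(−) → Φ^gp` [Prop. 4.4 (iii)],
`Div_B : B → Φ^gp`" — i.e. `B`, with `Div_B`, IS the rational function monoid of `C` in the sense
of `PreFrobenioid.RationalFunctionMonoidStr` (the hypothesis shape of Thm. 5.2 (iv)), for every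
Frobenioid structure `hF` on `C → F_Φ` (Thm. 5.2 (ii), first sentence, supplies one).
[cite: MochizukiFrdI2008, Thm. 5.2(ii) p.101] -/
def RationalFunctionMonoidIsB : Prop :=
  Hypotheses Φ B →
    ∀ hF : PreFrobenioid.IsFrobenioid (toElem Φ B DivB),
      Nonempty (PreFrobenioid.RationalFunctionMonoidStr (toElem Φ B DivB) hF B DivB)

/-- Unfolding of `RationalFunctionMonoidIsB` into its three printed clauses: objectwise
isomorphisms `B(A_D) ≅ O^×(A^birat)`, compatibility with `Div_B` / the divisor map of
Prop. 4.4 (iii), and naturality along linear morphisms (Prop. 2.2 (ii)).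
[cite: MochizukiFrdI2008, Thm. 5.2(ii) p.101] -/
theorem rationalFunctionMonoidIsB_iff :
    RationalFunctionMonoidIsB Φ B DivB ↔
      (Hypotheses Φ B → ∀ hF : PreFrobenioid.IsFrobenioid (toElem Φ B DivB),
        ∃ iso : ∀ A : ModelFrobenioid Φ B DivB,
            B.obj (op (PreFrobenioid.baseObj (toElem Φ B DivB) A)) ≃*
              PreFrobenioid.BiratUnits (toElem Φ B DivB) hF A,
          (∀ (A : ModelFrobenioid Φ B DivB)
              (b : B.obj (op (PreFrobenioid.baseObj (toElem Φ B DivB) A))),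
              PreFrobenioid.BiratUnits.divHom hF A (iso A b) =
                (DivB.app (op (PreFrobenioid.baseObj (toElem Φ B DivB) A))).hom b) ∧
            ∀ ⦃A A' : ModelFrobenioid Φ B DivB⦄ (ψ : A ⟶ A'),
              PreFrobenioid.IsLinear (toElem Φ B DivB) ψ →
                ∀ b' : B.obj (op (PreFrobenioid.baseObj (toElem Φ B DivB) A')),
                  PreFrobenioid.BiratUnits.Intertwines hF ψ
                    (iso A ((B.map (PreFrobenioid.Base (toElem Φ B DivB) ψ).op).hom b'))
                    (iso A' b')) := by
  refine forall_congr' fun _ => forall_congr' fun hF => ?_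
  constructor
  · rintro ⟨S⟩
    exact ⟨S.iso, S.div_iso, S.natural⟩
  · rintro ⟨iso, hdiv, hnat⟩
    exact ⟨⟨iso, hdiv, hnat⟩⟩

end ModelFrobenioid

end Literature.AlgebraicGeometry.Frobenioids
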